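import Literature.NumberTheory.Automorphic.SatakeParametersModP
import Mathlib.RingTheory.Localization.Submodule
import HarnessLib

/-!
# Herzig's Satake isomorphism in characteristic `p` for `GL_n`: when `q = 0` in `R`, the counting transform
# `𝒮'(f)(t) = ∑_{u ∈ U(F)/U(𝒪)} f(tu)` maps `ℋ_R(GL_n(F), GL_n(𝒪))` isomorphically onto the `R`-algebra of Laurent
# polynomials supported on ANTIDOMINANT exponents (Herzig, Compositio 147 (2011), Thm. 1.2, Cor. 1.3, case `V = 1`)

Topic `NumberTheory/Automorphic`; namespace `Literature.NumberTheory.Automorphic` (lane `lit-hodgefound`, Track 2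
foundations; seat `lit-hodgefound-p11`, generation 42, row g42-#12).  THEOREMS ONLY: no definition, no named fact, no
instance, no notation.  The tree's `SatakeTransformModP` (for `q` a UNIT of `R`) records: «For `p ∣ q`, i.e. `q = 0` in `R`,
the mod-`p` Satake transform of Herzig / Henniart–Vignéras is a different map and is not what is defined here».  That map is
the COUNTING transform `𝒮_1 = (isIwasawaExponent_gl hϖ).satakeTransform 1` of `SatakeTransformIwasawa` /
`SatakeTransformGLIwasawaDatum` (weight `w = 1`: the coefficient of `x^μ` in `𝒮_1(T_{KgK})` is `#{γ ∈ KgK/K : γ = u ϖ^μ K}`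
`= ∑_{u ∈ U(F)/U(𝒪)} 𝟙_{KgK}(ϖ^μ u)`, Herzig's `𝒮` for the trivial weight `V`, Treumann–Venkatesh's `𝒮^*`), defined over
EVERY commutative ring `R`, injective over every `R` (g42-#1 `satakeTransform_gl_injective_of_commRing`).  Here, for `R` with
`q = #𝓀 = 0` in `R` (e.g. `R = 𝔽̄_p`, `p` the residue characteristic) and every `F` with a `ValuativeRel` whose valuation ring is
a DVR with finite residue field: **its image is the `R`-algebra of Laurent polynomials `∑ c_μ x^μ` with every `μ` MONOTONE**
(`μ_1 ≤ ⋯ ≤ μ_n`, i.e. `ϖ^μ ∈ T⁻ = {t : ord(α(t)) ≤ 0 ∀ α > 0}`, antidominant for the upper-triangular Borel) — Herzig's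
`ℋ_T^-` —, so `ℋ_R(GL_n(F), GL_n(𝒪)) ≅ R[X_*(T)_-]` (Cor. 1.3).  Proof for `GL_n`: the transversal `u_ā ϖ^{ε_S}` of
`K t_r K/K` (`HeckeTransversalGL`) gives `𝒮_1(T_r) = ∑_{#S = n-r} q^{c(S)} x^{ε_S}` over any `R`, and `c(S) = 0` only for the
initial segment `S`, whose `ε_S` is the monotone `(0^{n-r}, 1^r)`; so for `q = 0`, `𝒮_1(T_r) = x^{(0^{n-r},1^r)}`, and the
integral generators theorem `ℋ_R = R[T_1, …, T_n, T_n⁻¹]` of g42-#3 identifies the image.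

## The print

[Herzig2010] Thm. 1.2 (arXiv p. 3): «Suppose that `V` is an irreducible representation of `G(k)` over `k̄`.  Then
`𝒮 : ℋ_G(V) → ℋ_T(V^{U(k)})`, `f ↦ (t ↦ ∑_{u ∈ U(F)/U(𝒪)} f(tu)|_{V^{U(k)}})` is an injective `k̄`-algebra homomorphism with
image `ℋ_T^-(V^{U(k)})`», `T⁻ = {t ∈ T(F) : (ord_F ∘ α)(t) ≤ 0 ∀ α ∈ Φ⁺}`; Cor. 1.3: «`ℋ_G(V)` is commutative and isomorphic
to `k̄[X_*(S)_-]`.  In particular it is noetherian».  Here `G = GL_n`, `V` trivial, coefficients any `R` with `q = 0`.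
[TreumannVenkatesh2016] §7.2 (`𝒮^*(f)(t) = ∫_U f(tu) du`).  [BruhatTits1972] (4.4.4) (ii) (injectivity over any `R`, g42-#1).

## What is formalised (theorems only)

* §1 (any `R`) **`satakeTransform_one_doubleCosetOperator_heckeDiag`** (`𝒮_1(T_r) = ∑_{#S = n-r} q^{c(S)} • x^{ε_S}`,
  `c(S) = #echelonPositions S`), the combinatorics `eq_filter_lt_of_card_echelonPositions_eq_zero`,
  `card_echelonPositions_filter_lt`, `epsOf_filter_lt`.
* §2 (`q = 0` in `R`) **`satakeTransform_one_doubleCosetOperator_heckeDiag_of_natCard_eq_zero`** (`𝒮_1(T_r) = x^{(0^{n-r}, 1^r)}`),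
  `satakeTransform_one_doubleCosetOperator_zpowDiagGL_indicator_le_of_natCard_eq_zero` (the g42 generators),
  `…_zpowDiagGL_one_…` / `…_neg_one_…` (`T_{ϖ^{±1} 1_n} ↦ x^{±𝟙}`).
* §3 (`q = 0` in `R`) `monotone_of_coeff_satakeTransform_one_ne_zero` (the image is supported on monotone exponents),
  `single_mem_range_satakeTransform_one_of_monotone` (every antidominant monomial is attained),
  **`mem_range_satakeTransform_one_iff_of_natCard_eq_zero`** (HERZIG Thm. 1.2 for `GL_n`, `V = 1`: `f ∈ 𝒮_1(ℋ_R)` iff every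
  exponent of `f` is monotone), **`exists_algEquiv_range_satakeTransform_one`** (`ℋ_R ≃ₐ[R]` that image, lifting `𝒮_1`).
* §4 (any `R`) `isNoetherianRing_heckeAlgebra_glInt` (Cor. 1.3 «in particular it is noetherian», from g42-#4's
  `ℋ_R ≅ R[X_1, …, X_n][X_n⁻¹]`, for `R` noetherian).

## References
* [Herzig2010] F. Herzig, *A Satake isomorphism in characteristic p*, Compositio Math. 147 (2011), 263–283, Thm. 1.2, Cor. 1.3.
* [TreumannVenkatesh2016] D. Treumann, A. Venkatesh, *Functoriality, Smith theory, and the Brauer homomorphism*,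
  Ann. of Math. 183 (2016), §7.2.
* [BruhatTits1972] F. Bruhat, J. Tits, *Groupes réductifs sur un corps local I*, Publ. Math. IHÉS 41 (1972), Prop. (4.4.4).
-/

noncomputable section

open scoped MatrixGroups Pointwise
open MulAction ValuativeRel Matrix Finset MonoidAlgebra Representation Literature.LinearAlgebra.Matrix.Echelon

namespace Literature.NumberTheory.Automorphic

open Echelon

/-! ## §1 The counting transform of `T_r` over any `R` -/

section Counting

variable {F : Type*} [Field F] [ValuativeRel F] {n : ℕ} [IsDiscreteValuationRing 𝒪[F]] [Finite 𝓀[F]] {ϖ : F}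
  {R : Type*} [CommRing R] [IsHeckeTriple (⊤ : Submonoid (GL (Fin n) F)) (glInt n F) (glInt n F)]

/-- **`𝒮_1(T_r) = ∑_{#S = n-r} q^{c(S)} x^{ε_S}` over ANY commutative ring `R`** (`r ≤ n`): the counting transform
(`w = 1`, Herzig's `𝒮` / Treumann–Venkatesh's `𝒮^*`) of `T_r = T_{K t_r K}`, computed on the transversal `u_ā ϖ^{ε_S}` of
`K t_r K / K` (`HeckeTransversalGL`: `#S = n - r`, `q^{c(S)}` echelon tables `ā`, `c(S) = #echelonPositions S`,
`e(u_ā ϖ^{ε_S}) = ε_S`). [cite: Herzig2010, Thm. 1.2] [cite: TreumannVenkatesh2016, §7.2] -/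
theorem satakeTransform_one_doubleCosetOperator_heckeDiag (hϖ : IsUniformizingElement ϖ) {r : ℕ} (hr : r ≤ n) :
    (isIwasawaExponent_gl hϖ).satakeTransform (1 : Multiplicative (Fin n → ℤ) →* R)
        (heckeAlgebra.doubleCosetOperator (glInt n F) (heckeDiag n (Units.mk0 ϖ hϖ.ne_zero) r)) =
      ∑ S ∈ (Finset.univ : Finset (Finset (Fin n))).filter (fun S => S.card = n - r),
        ((Nat.card 𝓀[F] : ℕ) ^ (echelonPositions S).card) •
          AddMonoidAlgebra.single (fun i => (epsOf S i : ℤ)) (1 : R) := by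
  classical
  haveI : Fintype 𝓀[F] := Fintype.ofFinite _
  have hqcard : Fintype.card 𝓀[F] = Nat.card 𝓀[F] := by rw [Nat.card_eq_fintype_card]
  -- Step 1: the sum over the orbit is a sum over the transversal `{u_a ϖ^{ε_S}}`
  have hbij := bijOn_heckeTransversal (n := n) hϖ hr
  rw [(isIwasawaExponent_gl hϖ).satakeTransform_doubleCosetOperator]
  simp_rw [MonoidHom.one_apply]
  have himg : (finite_orbit_quotient (glInt n F) (heckeDiag n (Units.mk0 ϖ hϖ.ne_zero) r)).toFinset =
      (heckeTransversal (n := n) hϖ.ne_zero r).image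
        (fun y : GL (Fin n) F => (y : GL (Fin n) F ⧸ glInt n F)) := by
    ext γ
    rw [Set.Finite.mem_toFinset, Finset.mem_image]
    constructor
    · intro hγ
      obtain ⟨y, hy, rfl⟩ := hbij.surjOn hγ
      exact ⟨y, hy, rfl⟩
    · rintro ⟨y, hy, rfl⟩
      exact hbij.mapsTo hy
  rw [himg, Finset.sum_image fun x hx y hy h => hbij.injOn hx hy h, sum_heckeTransversal hϖ]
  -- Step 2: the exponent of a representative is `ε_S`
  have hrep : ∀ p : TransversalIndex n F r,
      iwasawaExp hϖ ((p.rep hϖ.ne_zero : GL (Fin n) F ⧸ glInt n F).out) =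
        fun i => (epsOf p.1.1 i : ℤ) := by
    rintro ⟨⟨S, ā⟩, hS, h⟩
    rw [iwasawaExp_out_coe]
    change iwasawaExp hϖ (heckeRep hϖ.ne_zero h) = _
    rw [heckeRep_eq_mul, iwasawaExp_unipotent_mul_piPowGL hϖ (echelonGL_mem_upperUnitriangular h)]
  simp_rw [hrep]
  -- Step 3: count the tables with a given pivot set
  rw [sum_transversalIndex_of_fst r (fun S : Finset (Fin n) =>
    AddMonoidAlgebra.single (fun i => (epsOf S i : ℤ)) (1 : R)), hqcard]

omit [ValuativeRel F] [IsDiscreteValuationRing 𝒪[F]] [Finite 𝓀[F]]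
  [IsHeckeTriple (⊤ : Submonoid (GL (Fin n) F)) (glInt n F) (glInt n F)] in
/-- **The only pivot set without echelon positions is the initial segment**: if no pair `i < j` has `i ∉ S`, `j ∈ S`, then
`S = {i : i < #S}`. [folklore] [cite: Herzig2010, Thm. 1.2] -/
theorem eq_filter_lt_of_card_echelonPositions_eq_zero {S : Finset (Fin n)} (h : (echelonPositions S).card = 0) :
    S = Finset.univ.filter fun i : Fin n => (i : ℕ) < S.card := by
  classical
  rw [Finset.card_eq_zero] at h
  -- `S` is down-closed
  have hdown : ∀ i j : Fin n, i < j → j ∈ S → i ∈ S := by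
    intro i j hij hj
    by_contra hi
    have : (i, j) ∈ echelonPositions S := by
      rw [echelonPositions, Finset.mem_filter]
      exact ⟨Finset.mem_univ _, hij, hi, hj⟩
    rw [h] at this
    exact Finset.notMem_empty _ this
  ext i
  rw [Finset.mem_filter, and_iff_right (Finset.mem_univ i)]
  constructor
  · intro hi
    -- all `j ≤ i` are in `S`, so `#S ≥ i + 1`
    have hsub : Finset.univ.filter (fun j : Fin n => (j : ℕ) < (i : ℕ) + 1) ⊆ S := by
      intro j hj
      rw [Finset.mem_filter] at hj
      rcases lt_or_eq_of_le (Nat.lt_succ_iff.1 hj.2) with hlt | heq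
      · exact hdown j i (Fin.lt_def.2 hlt) hi
      · rw [Fin.ext heq]; exact hi
    have := Finset.card_le_card hsub
    rw [Fin.card_filter_val_lt] at this
    have hi' := i.isLt
    omega
  · intro hi
    by_contra hiS
    -- all of `S` lies below `i`, so `#S ≤ i`
    have hsub : S ⊆ Finset.univ.filter (fun j : Fin n => (j : ℕ) < (i : ℕ)) := by
      intro j hj
      rw [Finset.mem_filter]
      refine ⟨Finset.mem_univ _, ?_⟩
      rcases lt_trichotomy (j : ℕ) (i : ℕ) with hlt | heq | hgt
      · exact hlt
      · exact absurd (Fin.ext heq ▸ hj) hiS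
      · exact absurd (hdown i j (Fin.lt_def.2 hgt) hj) hiS
    have := Finset.card_le_card hsub
    rw [Fin.card_filter_val_lt] at this
    omega

omit [ValuativeRel F] [IsDiscreteValuationRing 𝒪[F]] [Finite 𝓀[F]]
  [IsHeckeTriple (⊤ : Submonoid (GL (Fin n) F)) (glInt n F) (glInt n F)] in
/-- The initial segment has no echelon positions. [folklore] [cite: Herzig2010, Thm. 1.2] -/
theorem card_echelonPositions_filter_lt (m : ℕ) :
    (echelonPositions (Finset.univ.filter fun i : Fin n => (i : ℕ) < m)).card = 0 := by
  classical
  rw [Finset.card_eq_zero, Finset.eq_empty_iff_forall_notMem]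
  rintro ⟨i, j⟩ hij
  rw [echelonPositions, Finset.mem_filter, Finset.mem_filter, Finset.mem_filter] at hij
  obtain ⟨-, hlt, hi, hj⟩ := hij
  exact hi ⟨Finset.mem_univ _, lt_trans (Fin.lt_def.1 hlt) hj.2⟩

omit [ValuativeRel F] [IsDiscreteValuationRing 𝒪[F]] [Finite 𝓀[F]]
  [IsHeckeTriple (⊤ : Submonoid (GL (Fin n) F)) (glInt n F) (glInt n F)] in
/-- `ε` of the initial segment `{i < m}` is the monotone vector `(0^m, 1^{n-m})`. [folklore] [cite: Herzig2010, Thm. 1.2] -/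
theorem epsOf_filter_lt (m : ℕ) :
    (fun i : Fin n => (epsOf (Finset.univ.filter fun i : Fin n => (i : ℕ) < m) i : ℤ)) =
      fun i : Fin n => if (i : ℕ) < m then (0 : ℤ) else 1 := by
  funext i
  simp only [epsOf, Finset.mem_filter, Finset.mem_univ, true_and]
  split_ifs <;> simp

/-! ## §2 `q = 0` in `R`: the generators go to antidominant monomials -/

/-- **`𝒮_1(T_r) = x^{(0^{n-r}, 1^r)}` WHEN `q = 0` IN `R`** (`r ≤ n`; e.g. `R` of characteristic `p`, the residue
characteristic): all pivot sets but the initial segment contribute a positive power of `q`. [cite: Herzig2010, Thm. 1.2] -/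
theorem satakeTransform_one_doubleCosetOperator_heckeDiag_of_natCard_eq_zero (hϖ : IsUniformizingElement ϖ)
    (hq0 : ((Nat.card 𝓀[F] : ℕ) : R) = 0) {r : ℕ} (hr : r ≤ n) :
    (isIwasawaExponent_gl hϖ).satakeTransform (1 : Multiplicative (Fin n → ℤ) →* R)
        (heckeAlgebra.doubleCosetOperator (glInt n F) (heckeDiag n (Units.mk0 ϖ hϖ.ne_zero) r)) =
      AddMonoidAlgebra.single (fun i : Fin n => if (i : ℕ) < n - r then (0 : ℤ) else 1) (1 : R) := by
  classical
  rw [satakeTransform_one_doubleCosetOperator_heckeDiag hϖ hr,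
    Finset.sum_eq_single_of_mem (Finset.univ.filter fun i : Fin n => (i : ℕ) < n - r)]
  · rw [card_echelonPositions_filter_lt, pow_zero, one_smul, epsOf_filter_lt]
  · rw [Finset.mem_filter, Fin.card_filter_val_lt]
    exact ⟨Finset.mem_univ _, by omega⟩
  · intro S hS hne
    rw [Finset.mem_filter] at hS
    have hc : (echelonPositions S).card ≠ 0 := fun h0 => hne (by rw [eq_filter_lt_of_card_echelonPositions_eq_zero h0, hS.2])
    rw [← Nat.cast_smul_eq_nsmul R, Nat.cast_pow, hq0, zero_pow hc, zero_smul]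

/-- The g42 generator `c_{(1^{r+1})} = T_{ϖ^{𝟙_{i ≤ r}}}` (`r : Fin n`) goes to `x^{(0^{n-1-r}, 1^{r+1})}` when `q = 0` in `R`.
[cite: Herzig2010, Thm. 1.2] -/
theorem satakeTransform_one_doubleCosetOperator_zpowDiagGL_indicator_le_of_natCard_eq_zero (hϖ : IsUniformizingElement ϖ)
    (hq0 : ((Nat.card 𝓀[F] : ℕ) : R) = 0) (r : Fin n) :
    (isIwasawaExponent_gl hϖ).satakeTransform (1 : Multiplicative (Fin n → ℤ) →* R)
        (heckeAlgebra.doubleCosetOperator (glInt n F)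
          (zpowDiagGL hϖ.ne_zero fun i : Fin n => if (i : ℕ) ≤ (r : ℕ) then (1 : ℤ) else 0)) =
      AddMonoidAlgebra.single (fun i : Fin n => if (i : ℕ) < n - ((r : ℕ) + 1) then (0 : ℤ) else 1) (1 : R) := by
  rw [zpowDiagGL_indicator_le_eq_heckeDiag,
    satakeTransform_one_doubleCosetOperator_heckeDiag_of_natCard_eq_zero hϖ hq0 (Nat.succ_le_of_lt r.isLt)]

/-- `𝒮_1(T_{ϖ 1_n}) = x^{𝟙}` when `q = 0` in `R` (in fact over any `R`: a single coset). [cite: Herzig2010, Thm. 1.2] -/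
theorem satakeTransform_one_doubleCosetOperator_zpowDiagGL_one_of_natCard_eq_zero (hϖ : IsUniformizingElement ϖ)
    (hq0 : ((Nat.card 𝓀[F] : ℕ) : R) = 0) :
    (isIwasawaExponent_gl hϖ).satakeTransform (1 : Multiplicative (Fin n → ℤ) →* R)
        (heckeAlgebra.doubleCosetOperator (glInt n F) (zpowDiagGL hϖ.ne_zero fun _ : Fin n => (1 : ℤ))) =
      AddMonoidAlgebra.single (fun _ : Fin n => (1 : ℤ)) (1 : R) := by
  rw [← heckeDiag_mk0_self_eq_zpowDiagGL_one, satakeTransform_one_doubleCosetOperator_heckeDiag_of_natCard_eq_zero hϖ hq0 le_rfl]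
  congr 1
  funext i
  rw [Nat.sub_self, if_neg (Nat.not_lt_zero _)]

/-- `𝒮_1(T_{ϖ⁻¹ 1_n}) = x^{-𝟙}` when `q = 0` in `R` (the inverse of `𝒮_1(T_{ϖ 1_n}) = x^{𝟙}`). [cite: Herzig2010, Thm. 1.2] -/
theorem satakeTransform_one_doubleCosetOperator_zpowDiagGL_neg_one_of_natCard_eq_zero (hϖ : IsUniformizingElement ϖ)
    (hq0 : ((Nat.card 𝓀[F] : ℕ) : R) = 0) :
    (isIwasawaExponent_gl hϖ).satakeTransform (1 : Multiplicative (Fin n → ℤ) →* R)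
        (heckeAlgebra.doubleCosetOperator (glInt n F) (zpowDiagGL hϖ.ne_zero fun _ : Fin n => (-1 : ℤ))) =
      AddMonoidAlgebra.single (fun _ : Fin n => (-1 : ℤ)) (1 : R) := by
  have h1 : (isIwasawaExponent_gl hϖ).satakeTransform (1 : Multiplicative (Fin n → ℤ) →* R)
        (heckeAlgebra.doubleCosetOperator (glInt n F) (zpowDiagGL hϖ.ne_zero fun _ : Fin n => (-1 : ℤ))) *
      (isIwasawaExponent_gl hϖ).satakeTransform (1 : Multiplicative (Fin n → ℤ) →* R)
        (heckeAlgebra.doubleCosetOperator (glInt n F) (zpowDiagGL hϖ.ne_zero fun _ : Fin n => (1 : ℤ))) = 1 := by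
    rw [← map_mul, doubleCosetOperator_zpowDiagGL_neg_one_mul_one_of_commRing hϖ, map_one]
  have h0 : ((fun _ : Fin n => (1 : ℤ)) + fun _ : Fin n => (-1 : ℤ)) = 0 := funext fun _ => by simp
  have h2 : (isIwasawaExponent_gl hϖ).satakeTransform (1 : Multiplicative (Fin n → ℤ) →* R)
        (heckeAlgebra.doubleCosetOperator (glInt n F) (zpowDiagGL hϖ.ne_zero fun _ : Fin n => (1 : ℤ))) *
      AddMonoidAlgebra.single (fun _ : Fin n => (-1 : ℤ)) (1 : R) = 1 := by
    rw [AddMonoidAlgebra.one_def, satakeTransform_one_doubleCosetOperator_zpowDiagGL_one_of_natCard_eq_zero hϖ hq0,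
      AddMonoidAlgebra.single_mul_single, h0, mul_one]
  exact left_inv_eq_right_inv h1 h2

/-! ## §3 The image: Laurent polynomials supported on antidominant (monotone) exponents -/

/-- **The counting transform is supported on monotone exponents when `q = 0` in `R`**: `ℋ_R` is generated by the `T_r` and
`T_{ϖ⁻¹ 1_n}` (g42-#3), whose transforms are monomials with monotone exponents, and monotone exponents are stable under
addition. [cite: Herzig2010, Thm. 1.2] -/
theorem monotone_of_coeff_satakeTransform_one_ne_zero (hϖ : IsUniformizingElement ϖ) (hq0 : ((Nat.card 𝓀[F] : ℕ) : R) = 0)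
    (T : heckeAlgebra R (GL (Fin n) F) (glInt n F)) {μ : Fin n → ℤ}
    (hμ : ((isIwasawaExponent_gl hϖ).satakeTransform (1 : Multiplicative (Fin n → ℤ) →* R) T).coeff μ ≠ 0) : Monotone μ := by
  classical
  -- the property "all exponents monotone" holds on the generators and is stable under the algebra operations
  have hT : T ∈ Algebra.adjoin R (insert (heckeAlgebra.doubleCosetOperator (k := R) (glInt n F)
      (zpowDiagGL hϖ.ne_zero fun _ : Fin n => (-1 : ℤ)))
      (Set.range fun r : Fin n => heckeAlgebra.doubleCosetOperator (k := R) (glInt n F)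
        (zpowDiagGL hϖ.ne_zero fun i : Fin n => if (i : ℕ) ≤ (r : ℕ) then (1 : ℤ) else 0))) := by
    rw [adjoin_glInt_zpowDiagGL_insert_eq_top_of_commRing hϖ]
    exact Algebra.mem_top
  -- a monomial `c x^ν` with `ν` monotone has monotone exponents
  have hsingle : ∀ {μ : Fin n → ℤ} (ν : Fin n → ℤ) (c : R), Monotone ν →
      (AddMonoidAlgebra.single ν c).coeff μ ≠ 0 → Monotone μ := by
    intro μ ν c hν h
    rw [AddMonoidAlgebra.coeff_single, Finsupp.single_apply] at h
    by_cases hνμ : ν = μ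
    · exact hνμ ▸ hν
    · exact absurd (if_neg hνμ) h
  revert μ
  refine Algebra.adjoin_induction (p := fun T _ => ∀ {μ : Fin n → ℤ},
      ((isIwasawaExponent_gl hϖ).satakeTransform (1 : Multiplicative (Fin n → ℤ) →* R) T).coeff μ ≠ 0 → Monotone μ)
    ?_ ?_ ?_ ?_ hT
  · -- generators: monomials with monotone exponent
    intro x hx μ hμ
    rcases hx with rfl | ⟨r, rfl⟩
    · rw [satakeTransform_one_doubleCosetOperator_zpowDiagGL_neg_one_of_natCard_eq_zero hϖ hq0] at hμ
      exact hsingle _ _ (fun _ _ _ => le_rfl) hμ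
    · rw [satakeTransform_one_doubleCosetOperator_zpowDiagGL_indicator_le_of_natCard_eq_zero hϖ hq0] at hμ
      exact hsingle _ _ (fun i j hij => by
        show (if (i : ℕ) < n - ((r : ℕ) + 1) then (0 : ℤ) else 1) ≤ if (j : ℕ) < n - ((r : ℕ) + 1) then (0 : ℤ) else 1
        split_ifs with h1 h2 h2
        · exact le_rfl
        · exact zero_le_one
        · exact absurd (lt_of_le_of_lt (Fin.le_def.1 hij) h2) h1
        · exact le_rfl) hμ
  · -- scalars: `c x^0`
    intro c μ hμ
    rw [AlgHom.commutes, AddMonoidAlgebra.coe_algebraMap, Function.comp_apply] at hμ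
    exact hsingle _ _ (fun _ _ _ => le_rfl) hμ
  · -- sums
    intro x y _ _ hx hy μ hμ
    rw [map_add, AddMonoidAlgebra.coeff_add, Finsupp.add_apply] at hμ
    by_cases h : ((isIwasawaExponent_gl hϖ).satakeTransform (1 : Multiplicative (Fin n → ℤ) →* R) x).coeff μ = 0
    · rw [h, zero_add] at hμ
      exact hy hμ
    · exact hx h
  · -- products: exponents add
    intro x y _ _ hx hy μ hμ
    rw [map_mul] at hμ
    obtain ⟨a, ha, b, hb, rfl⟩ := Finset.mem_add.1
      (AddMonoidAlgebra.support_coeff_mul_subset _ _ (Finsupp.mem_support_iff.2 hμ))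
    exact fun i j hij => add_le_add (hx (Finsupp.mem_support_iff.1 ha) hij) (hy (Finsupp.mem_support_iff.1 hb) hij)

/-- **Every antidominant monomial `x^μ` (`μ` monotone) is a counting transform when `q = 0` in `R`**: for `μ ≥ 0` with
`μ_1 = 0` peel off the generator monomials `x^{(0^{i₀}, 1^{n-i₀})} = 𝒮_1(T_{n-i₀})` (induction on `|μ|`), and multiply by a
power of the unit `x^{±𝟙} = 𝒮_1(T_{ϖ^{±1} 1_n})`. [cite: Herzig2010, Thm. 1.2, Cor. 1.3] -/
theorem single_mem_range_satakeTransform_one_of_monotone (hϖ : IsUniformizingElement ϖ)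
    (hq0 : ((Nat.card 𝓀[F] : ℕ) : R) = 0) {μ : Fin n → ℤ} (hμ : Monotone μ) :
    AddMonoidAlgebra.single μ (1 : R) ∈
      ((isIwasawaExponent_gl hϖ).satakeTransform (1 : Multiplicative (Fin n → ℤ) →* R)).range := by
  classical
  set A := ((isIwasawaExponent_gl hϖ).satakeTransform (1 : Multiplicative (Fin n → ℤ) →* R)).range with hA
  -- the generator monomials, `x^{𝟙}` and `x^{-𝟙}` lie in `A`
  have hgen : ∀ i₀ : ℕ, i₀ < n →
      AddMonoidAlgebra.single (fun i : Fin n => if (i : ℕ) < i₀ then (0 : ℤ) else 1) (1 : R) ∈ A := by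
    intro i₀ hi₀
    have h := satakeTransform_one_doubleCosetOperator_zpowDiagGL_indicator_le_of_natCard_eq_zero (n := n) (R := R) hϖ hq0
      ⟨n - 1 - i₀, by omega⟩
    have hidx : n - ((n - 1 - i₀ : ℕ) + 1) = i₀ := by omega
    simp only [hidx] at h
    exact ⟨_, h⟩
  have hone : AddMonoidAlgebra.single (fun _ : Fin n => (1 : ℤ)) (1 : R) ∈ A :=
    ⟨_, satakeTransform_one_doubleCosetOperator_zpowDiagGL_one_of_natCard_eq_zero hϖ hq0⟩
  have hneg : AddMonoidAlgebra.single (fun _ : Fin n => (-1 : ℤ)) (1 : R) ∈ A :=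
    ⟨_, satakeTransform_one_doubleCosetOperator_zpowDiagGL_neg_one_of_natCard_eq_zero hϖ hq0⟩
  -- non-negative monotone exponents, by induction on the total `|μ|`
  have hnonneg : ∀ (N : ℕ) (ν : Fin n → ℤ), Monotone ν → (∀ i, 0 ≤ ν i) → ∑ i, ν i ≤ N →
      AddMonoidAlgebra.single ν (1 : R) ∈ A := by
    intro N
    induction N with
    | zero =>
      intro ν _ hν0 hsum
      have h0 : ν = 0 := funext fun i => by
        rw [Pi.zero_apply]
        have := Finset.single_le_sum (fun j _ => hν0 j) (Finset.mem_univ i)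
        have := hν0 i
        push_cast at hsum
        omega
      rw [h0, ← AddMonoidAlgebra.one_def]
      exact Subalgebra.one_mem _
    | succ N ih =>
      intro ν hν hν0 hsum
      by_cases h0 : ∀ i, ν i = 0
      · rw [show ν = 0 from funext h0, ← AddMonoidAlgebra.one_def]
        exact Subalgebra.one_mem _
      -- `i₀` = the first index with `ν_{i₀} > 0`; peel `ε = 𝟙_{i ≥ i₀}`
      have hne : (Finset.univ.filter fun i : Fin n => 0 < ν i).Nonempty := by
        obtain ⟨i, hi⟩ := not_forall.1 h0
        exact ⟨i, Finset.mem_filter.2 ⟨Finset.mem_univ _, lt_of_le_of_ne (hν0 i) (Ne.symm hi)⟩⟩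
      set i₀ := (Finset.univ.filter fun i : Fin n => 0 < ν i).min' hne with hi₀
      have hi₀pos : 0 < ν i₀ := (Finset.mem_filter.1 (Finset.min'_mem _ hne)).2
      have hlt : ∀ i : Fin n, (i : ℕ) < (i₀ : ℕ) → ν i = 0 := by
        intro i hi
        by_contra h
        have := Finset.min'_le (Finset.univ.filter fun i : Fin n => 0 < ν i) i
          (Finset.mem_filter.2 ⟨Finset.mem_univ _, lt_of_le_of_ne (hν0 i) (Ne.symm h)⟩)
        rw [← hi₀] at this
        exact absurd hi (not_lt.2 (Fin.le_def.1 this))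
      have hge : ∀ i : Fin n, (i₀ : ℕ) ≤ (i : ℕ) → 1 ≤ ν i := fun i hi => le_trans (by omega) (hν (Fin.le_def.2 hi))
      set ε : Fin n → ℤ := fun i => if (i : ℕ) < (i₀ : ℕ) then (0 : ℤ) else 1 with hε
      set ν' : Fin n → ℤ := fun i => ν i - ε i with hν'
      have hν'mono : Monotone ν' := by
        intro i j hij
        simp only [hν', hε]
        have hmono := hν hij
        have hij' := Fin.le_def.1 hij
        by_cases h1 : (i : ℕ) < (i₀ : ℕ)
        · rw [if_pos h1, hlt i h1]
          by_cases h2 : (j : ℕ) < (i₀ : ℕ)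
          · rw [if_pos h2, hlt j h2]
          · rw [if_neg h2]
            have := hge j (not_lt.1 h2)
            omega
        · rw [if_neg h1, if_neg (by omega)]
          omega
      have hν'0 : ∀ i, 0 ≤ ν' i := by
        intro i
        simp only [hν', hε]
        by_cases h1 : (i : ℕ) < (i₀ : ℕ)
        · rw [if_pos h1, hlt i h1]
          omega
        · rw [if_neg h1]
          have := hge i (not_lt.1 h1)
          omega
      have hεi₀ : ε i₀ = 1 := by simp only [hε, lt_irrefl, if_false]
      have hsum' : ∑ i, ν' i ≤ N := by
        have h1 : ∑ i, ν' i = ∑ i, ν i - ∑ i, ε i := by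
          simp only [hν', Finset.sum_sub_distrib]
        have h2 : 1 ≤ ∑ i, ε i := by
          rw [← hεi₀]
          exact Finset.single_le_sum (fun i _ => by simp only [hε]; split_ifs <;> omega) (Finset.mem_univ i₀)
        push_cast at hsum
        omega
      have hνeq : ν = ν' + ε := funext fun i => by simp only [hν', Pi.add_apply, sub_add_cancel]
      rw [hνeq, ← mul_one (1 : R), ← AddMonoidAlgebra.single_mul_single]
      exact Subalgebra.mul_mem _ (ih ν' hν'mono hν'0 hsum') (hgen i₀ i₀.isLt)
  -- general monotone `μ`: shift by the minimum `μ_1`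
  rcases Nat.eq_zero_or_pos n with hn | hn
  · subst hn
    rw [show μ = 0 from Subsingleton.elim _ _, ← AddMonoidAlgebra.one_def]
    exact Subalgebra.one_mem _
  set m := μ ⟨0, hn⟩ with hm
  set μ' : Fin n → ℤ := fun i => μ i - m with hμ'
  have hμ'mono : Monotone μ' := fun i j hij => by simp only [hμ']; linarith [hμ hij]
  have hμ'0 : ∀ i, 0 ≤ μ' i := fun i => by
    simp only [hμ', hm]
    linarith [hμ (Fin.mk_le_mk.2 (Nat.zero_le (i : ℕ)) : (⟨0, hn⟩ : Fin n) ≤ ⟨i, i.isLt⟩)]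
  have hμeq : μ = μ' + fun _ => m := funext fun i => by simp only [hμ', Pi.add_apply, sub_add_cancel]
  have hconst : AddMonoidAlgebra.single (fun _ : Fin n => m) (1 : R) ∈ A := by
    rcases le_or_gt 0 m with h0 | h0
    · have h := Subalgebra.pow_mem _ hone m.toNat
      rw [AddMonoidAlgebra.single_pow, one_pow] at h
      have hv : m.toNat • (fun _ : Fin n => (1 : ℤ)) = fun _ : Fin n => m := funext fun i => by
        simp only [Pi.smul_apply, nsmul_eq_mul, mul_one, Int.toNat_of_nonneg h0]
      rwa [hv] at h
    · have h := Subalgebra.pow_mem _ hneg (-m).toNat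
      rw [AddMonoidAlgebra.single_pow, one_pow] at h
      have hv : (-m).toNat • (fun _ : Fin n => (-1 : ℤ)) = fun _ : Fin n => m := funext fun i => by
        simp only [Pi.smul_apply, nsmul_eq_mul, mul_neg, mul_one, Int.toNat_of_nonneg (by omega : 0 ≤ -m), neg_neg]
      rwa [hv] at h
  rw [hμeq, ← mul_one (1 : R), ← AddMonoidAlgebra.single_mul_single]
  exact Subalgebra.mul_mem _ (hnonneg _ μ' hμ'mono hμ'0 (Int.self_le_toNat _)) hconst

omit [ValuativeRel F] [IsDiscreteValuationRing 𝒪[F]] [Finite 𝓀[F]]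
  [IsHeckeTriple (⊤ : Submonoid (GL (Fin n) F)) (glInt n F) (glInt n F)] in
/-- A Laurent polynomial is the sum of its monomials: `f = ∑_{μ ∈ supp f} f_μ x^μ`. [folklore] [cite: Herzig2010, Thm. 1.2] -/
theorem eq_sum_coeff_smul_single (f : AddMonoidAlgebra R (Fin n → ℤ)) :
    f = ∑ μ ∈ f.coeff.support, f.coeff μ • AddMonoidAlgebra.single μ (1 : R) := by
  classical
  refine AddMonoidAlgebra.ext (Finsupp.ext fun ν => ?_)
  rw [AddMonoidAlgebra.coeff_sum, Finsupp.finsetSum_apply]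
  simp only [AddMonoidAlgebra.coeff_smul, Finsupp.smul_apply, AddMonoidAlgebra.coeff_single, Finsupp.single_apply,
    smul_eq_mul, mul_ite, mul_one, mul_zero]
  rw [Finset.sum_ite_eq']
  split_ifs with h
  · rfl
  · exact Finsupp.notMem_support_iff.1 h

/-- **HERZIG'S SATAKE ISOMORPHISM IN CHARACTERISTIC `p` FOR `GL_n` (trivial weight), OVER ANY COMMUTATIVE RING `R` WITH
`q = 0` IN `R`**: the image of the counting transform `𝒮_1 : ℋ_R(GL_n(F), GL_n(𝒪)) → R[ℤⁿ]` (injective over every `R`, g42-#1)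
is exactly the algebra `ℋ_T^-` of Laurent polynomials supported on antidominant = monotone exponents: `f ∈ 𝒮_1(ℋ_R)` iff every
exponent of `f` is monotone («`𝒮` is an injective `k̄`-algebra homomorphism with image `ℋ_T^-`»).
[cite: Herzig2010, Thm. 1.2] [cite: TreumannVenkatesh2016, §7.2] -/
theorem mem_range_satakeTransform_one_iff_of_natCard_eq_zero (hϖ : IsUniformizingElement ϖ)
    (hq0 : ((Nat.card 𝓀[F] : ℕ) : R) = 0) (f : AddMonoidAlgebra R (Fin n → ℤ)) :
    f ∈ ((isIwasawaExponent_gl hϖ).satakeTransform (1 : Multiplicative (Fin n → ℤ) →* R)).range ↔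
      ∀ μ, f.coeff μ ≠ 0 → Monotone μ := by
  constructor
  · rintro ⟨T, rfl⟩ μ hμ
    exact monotone_of_coeff_satakeTransform_one_ne_zero hϖ hq0 T hμ
  · intro h
    rw [eq_sum_coeff_smul_single f]
    exact Subalgebra.sum_mem _ fun μ hμ =>
      Subalgebra.smul_mem _ (single_mem_range_satakeTransform_one_of_monotone hϖ hq0 (h μ (Finsupp.mem_support_iff.1 hμ))) _

omit [Finite 𝓀[F]] [IsHeckeTriple (⊤ : Submonoid (GL (Fin n) F)) (glInt n F) (glInt n F)] in
/-- **`ℋ_R(GL_n(F), GL_n(𝒪)) ≃ₐ[R] ℋ_T^- = R[X_*(T)_-]`** through `𝒮_1` when `q = 0` in `R` (Herzig Cor. 1.3: «`ℋ_G(V)` is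
commutative and isomorphic to `k̄[X_*(S)_-]`»; the target is the image described by
`mem_range_satakeTransform_one_iff_of_natCard_eq_zero`). [cite: Herzig2010, Cor. 1.3] [cite: BruhatTits1972, Prop. (4.4.4) (ii)] -/
theorem exists_algEquiv_range_satakeTransform_one (hϖ : IsUniformizingElement ϖ) :
    ∃ e : heckeAlgebra R (GL (Fin n) F) (glInt n F) ≃ₐ[R]
        ((isIwasawaExponent_gl hϖ).satakeTransform (1 : Multiplicative (Fin n → ℤ) →* R)).range,
      ∀ T, (e T : AddMonoidAlgebra R (Fin n → ℤ)) =
        (isIwasawaExponent_gl hϖ).satakeTransform (1 : Multiplicative (Fin n → ℤ) →* R) T :=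
  ⟨AlgEquiv.ofInjective _ (satakeTransform_gl_injective_of_commRing hϖ 1), fun _ => rfl⟩

end Counting

/-! ## §4 Noetherianity (any `R`) -/

section Noetherian

variable {F : Type*} [Field F] [ValuativeRel F] {n : ℕ} [IsDiscreteValuationRing 𝒪[F]] {ϖ : F}
  {R : Type*} [CommRing R] [IsHeckeTriple (⊤ : Submonoid (GL (Fin n) F)) (glInt n F) (glInt n F)]

/-- **`ℋ_R(GL_n(F), GL_n(𝒪))` (`n ≥ 1`) is noetherian whenever `R` is** (Herzig Cor. 1.3 «In particular it is noetherian»;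
here from g42-#4 `ℋ_R ≅ R[X_1, …, X_n][X_n⁻¹]`, any `R`). [cite: Herzig2010, Cor. 1.3] [cite: Macdonald1995, Ch. V (2.5), (2.7)] -/
theorem isNoetherianRing_heckeAlgebra_glInt [IsNoetherianRing R] (hϖ : IsUniformizingElement ϖ) (hn : 0 < n) :
    IsNoetherianRing (heckeAlgebra R (GL (Fin n) F) (glInt n F)) := by
  obtain ⟨e, -⟩ := exists_algEquiv_heckeAlgebra_glInt_localization_of_commRing (n := n) (R := R) hϖ (le_last_index_of_pos hn)
  exact isNoetherianRing_of_ringEquiv _ e.symm.toRingEquiv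

end Noetherian

end Literature.NumberTheory.Automorphic

end
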